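import Literature.NumberTheory.EllipticCurves.DivisionFieldRamificationProofs
import HarnessLib

/-!
# Bounding a ramification index by the index of a subgroup of `Γ_K` on which inertia acts through `Gal(K̄/L)`

`Proofs` file (theorems only: no definition, no named fact), topic `NumberTheory/GaloisRepresentations`;
companion of `DivisionFieldRamificationProofs.lean` (`…ramificationIdx_eq_one_of_inertia_le_fixingSubgroup`:
if the absolute inertia group `I_𝔓 ≤ Γ_K` fixes `L` pointwise then `e(Q ∣ v) = 1`) and of
`InertiaFixesPrimeToResidueRootsProofs.lean` / `InertiaFixesSquareRootsProofs.lean` (what `I_𝔓` fixes).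

For a number field `K`, `Γ_K = Gal(K̄/K)`, a finite Galois subextension `L ⊆ K̄` of `K`, a finite place `v` of
`K`, a prime `𝔓` of `\bar ℤ_K = integralClosure (𝓞 K) K̄` over `v` with inertia group `I_𝔓 ≤ Γ_K`:

* `inertia_ringOfIntegers_le_map_restrictNormalHom` — the inertia group of `P = 𝔓 ∩ 𝓞 L` in `Gal(L/K)` is
  contained in the restriction `res_L(I_𝔓)` (the tree's profinite lifting `exists_mem_inertia_restrict_eq`; the
  `𝓞 L`-phrased twin of `ArtinConductorIntegrality`'s `inertia_comap_le_map_restrictNormalHom`);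
* `card_map_restrictNormalHom_eq_relIndex` — `#res_L(I) = [I : I ∩ Gal(K̄/L)]` for any `I ≤ Γ_K`
  (Mathlib `Subgroup.relIndex_ker`, `IntermediateField.restrictNormalHom_ker`);
* `ramificationIdx_le_relIndex_fixingSubgroup_inertia` — `e(Q ∣ v) ≤ [I_𝔓 : I_𝔓 ∩ Gal(K̄/L)]` for every prime
  `Q` of `𝓞 L` over `v` (`e(Q ∣ v) = #I_P`, the tree's `ramificationIdx_eq_card_inertia_comap`);
* **`ramificationIdx_le_index_of_inertia_inf_le_fixingSubgroup`** — if `B ≤ Γ_K` has finite index and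
  `I_𝔓 ∩ B` fixes `L` pointwise, then **`e(Q ∣ v) ≤ [Γ_K : B]`** for every prime `Q` of `𝓞 L` over `v`
  (`[I_𝔓 : I_𝔓 ∩ Gal(K̄/L)] ≤ [I_𝔓 : I_𝔓 ∩ B] ≤ [Γ_K : B]`); `B = ⊤` is the `e = 1` criterion.

This is the form in which "`L` becomes unramified over the subfield cut out by `B` after a bounded extension" is
consumed without constructing that subfield: e.g. `B = ker ρ̄_{E,3} ∩ ker ρ̄_{E,5} ∩ (fixer of √a)` for the field
`F_tpd(√−1, √λ, √(λ−1), E_λ[15])` of the cell abc-iut's reading of [IUTchIV] Thm. 1.10 (sequel file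
`Literature/IUT/LogVolume/SubThetaFieldInertiaBound.lean`). Classical (Neukirch, *ANT* I §9: `e = #I`, inertia
groups in towers); nothing here bears on [IUTchIII] Cor. 3.12.

## References

* [NeukirchANT1999] J. Neukirch, *Algebraic Number Theory* (1999), Ch. I §9 Prop. (9.6), (9.9); Ch. II (9.11).
* [SerreLocalFields1979] J.-P. Serre, *Local Fields*, Ch. I §7 Prop. 22 (inertia groups of subextensions are
  images of inertia groups).
-/

noncomputable section

open scoped Pointwise IntermediateField NumberField

open NumberField IsDedekindDomain IntermediateField Field

universe u

namespace Literature.NumberTheory.GaloisRepresentations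

open Literature.NumberTheory.EllipticCurves

variable {K : Type u} [Field K] [NumberField K]

/-- **The inertia group of `P = 𝔓 ∩ 𝓞 L` in `Gal(L/K)` lies in the restriction to `L` of the absolute
inertia group `I_𝔓`** (every element of `I_P(Gal(L/K))` is the restriction of some `σ ∈ I_𝔓`: Serre,
*Local Fields* I §7 Prop. 22; Neukirch I (9.6)). [cite: SerreLocalFields1979, Ch. I §7 Prop. 22]
[cite: NeukirchANT1999, Ch. I §9 Prop. (9.6)] -/
theorem inertia_ringOfIntegers_le_map_restrictNormalHom (L : IntermediateField K (AlgebraicClosure K))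
    [FiniteDimensional K L] [IsGalois K L]
    (𝔓 : Ideal (integralClosure (𝓞 K) (AlgebraicClosure K))) [𝔓.IsPrime] :
    (𝔓.comap (ringOfIntegersToIntegralClosure (k := K) (Ω := AlgebraicClosure K) L)).inertia (L ≃ₐ[K] L) ≤
      (𝔓.inertia (AlgebraicClosure K ≃ₐ[K] AlgebraicClosure K)).map (AlgEquiv.restrictNormalHom L) := by
  intro g hg
  obtain ⟨σ, hσ, hσg⟩ := exists_mem_inertia_restrict_eq L 𝔓 g hg
  refine ⟨σ, hσ, AlgEquiv.ext fun x => Subtype.ext ?_⟩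
  rw [AlgEquiv.restrictNormalHom_apply]
  exact hσg x

omit [NumberField K] in
/-- **`#res_L(I) = [I : I ∩ Gal(K̄/L)]`**: the order of the image in `Gal(L/K)` of a subgroup `I ≤ Γ_K` under
restriction is the index in `I` of its intersection with the kernel `Gal(K̄/L)` of the restriction map
(Mathlib `Subgroup.relIndex_ker`, `IntermediateField.restrictNormalHom_ker`). [cite: NeukirchANT1999, Ch. I §9 (9.9)] -/
theorem card_map_restrictNormalHom_eq_relIndex (L : IntermediateField K (AlgebraicClosure K)) [Normal K L]
    (I : Subgroup (AlgebraicClosure K ≃ₐ[K] AlgebraicClosure K)) :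
    Nat.card (I.map (AlgEquiv.restrictNormalHom L)) = L.fixingSubgroup.relIndex I := by
  rw [← IntermediateField.restrictNormalHom_ker L, Subgroup.relIndex_ker]

/-- **`e(Q ∣ v) ≤ [I_𝔓 : I_𝔓 ∩ Gal(K̄/L)]`** for a finite Galois `L ⊆ K̄` over `K`, a prime `𝔓` of `\bar ℤ_K`
over `v` and every prime `Q` of `𝓞 L` over `v`: `e(Q ∣ v) = #I_P(Gal(L/K))` (Neukirch I (9.9), the tree's
`ramificationIdx_eq_card_inertia_comap`) and `I_P(Gal(L/K)) ≤ res_L(I_𝔓)`. (In fact equality holds; the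
inequality is what the bound below consumes.) [cite: NeukirchANT1999, Ch. I §9 Prop. (9.6) and (9.9)] -/
theorem ramificationIdx_le_relIndex_fixingSubgroup_inertia (L : IntermediateField K (AlgebraicClosure K))
    [FiniteDimensional K L] [IsGalois K L] (v : HeightOneSpectrum (𝓞 K))
    (𝔓 : Ideal (integralClosure (𝓞 K) (AlgebraicClosure K))) [𝔓.IsPrime] [𝔓.LiesOver v.asIdeal]
    (Q : Ideal (𝓞 L)) [Q.IsPrime] [Q.LiesOver v.asIdeal] :
    Q.ramificationIdx (𝓞 K) ≤
      L.fixingSubgroup.relIndex (𝔓.inertia (AlgebraicClosure K ≃ₐ[K] AlgebraicClosure K)) := by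
  rw [ramificationIdx_eq_card_inertia_comap L v 𝔓 Q, ← card_map_restrictNormalHom_eq_relIndex L]
  exact Subgroup.card_le_of_le (inertia_ringOfIntegers_le_map_restrictNormalHom L 𝔓)

/-- **`e(Q ∣ v) ≤ [Γ_K : B]` when `I_𝔓 ∩ B` fixes `L` pointwise.** Let `L ⊆ K̄` be finite Galois over `K`,
`𝔓` a prime of `\bar ℤ_K` over the finite place `v` of `K`, and `B ≤ Γ_K` a subgroup of finite index such
that every `σ ∈ I_𝔓 ∩ B` fixes `L` pointwise (`I_𝔓 ⊓ B ≤ Gal(K̄/L)`). Then `e(Q ∣ v) ≤ [Γ_K : B]` for every prime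
`Q` of `𝓞 L` over `v`: `e(Q ∣ v) ≤ [I_𝔓 : I_𝔓 ∩ Gal(K̄/L)] ≤ [I_𝔓 : I_𝔓 ∩ B] ≤ [Γ_K : B]`. (`B = ⊤`: the
unramifiedness criterion `…_eq_one_of_inertia_le_fixingSubgroup`; in general: `L` is unramified over `v` up to
index `[Γ_K : B]`, i.e. over the fixed field of `B`, without constructing that field.)
[cite: NeukirchANT1999, Ch. I §9 Prop. (9.6) and (9.9)] [cite: SerreLocalFields1979, Ch. I §7 Prop. 22] -/
theorem ramificationIdx_le_index_of_inertia_inf_le_fixingSubgroup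
    (L : IntermediateField K (AlgebraicClosure K)) [FiniteDimensional K L] [IsGalois K L]
    (v : HeightOneSpectrum (𝓞 K))
    (𝔓 : Ideal (integralClosure (𝓞 K) (AlgebraicClosure K))) [𝔓.IsPrime] [𝔓.LiesOver v.asIdeal]
    (B : Subgroup (AlgebraicClosure K ≃ₐ[K] AlgebraicClosure K)) (hB : B.index ≠ 0)
    (hI : 𝔓.inertia (AlgebraicClosure K ≃ₐ[K] AlgebraicClosure K) ⊓ B ≤ L.fixingSubgroup)
    (Q : Ideal (𝓞 L)) [Q.IsPrime] [Q.LiesOver v.asIdeal] :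
    Q.ramificationIdx (𝓞 K) ≤ B.index := by
  set I := 𝔓.inertia (AlgebraicClosure K ≃ₐ[K] AlgebraicClosure K) with hIdef
  -- `[I : I ∩ B] ≤ [Γ : B]`, in particular finite
  have hBtop : B.relIndex ⊤ ≠ 0 := by rwa [Subgroup.relIndex_top_right]
  have hBI : B.relIndex I ≤ B.index := by
    rw [← Subgroup.relIndex_top_right]
    exact Subgroup.relIndex_le_of_le_right le_top hBtop
  have hBI0 : (B ⊓ I).relIndex I ≠ 0 := by
    rw [Subgroup.inf_relIndex_right]
    exact fun h => hB (Subgroup.index_eq_zero_of_relIndex_eq_zero h)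
  -- `[I : I ∩ Gal(K̄/L)] ≤ [I : I ∩ B]` since `I ∩ B ≤ Gal(K̄/L)`
  have hNI : L.fixingSubgroup.relIndex I ≤ (B ⊓ I).relIndex I :=
    Subgroup.relIndex_le_of_le_left (by rw [inf_comm]; exact hI) hBI0
  rw [Subgroup.inf_relIndex_right] at hNI
  exact (ramificationIdx_le_relIndex_fixingSubgroup_inertia L v 𝔓 Q).trans (hNI.trans hBI)

/-- The same with the prime of `\bar ℤ_K = absIntegers (𝓞 K) K` given as a member of `v.primesAbove` and the
inertia read in `absoluteGaloisGroup K` (the conventions of `InertiaFixesPrimeToResidueRootsProofs.lean`).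
[cite: NeukirchANT1999, Ch. I §9 Prop. (9.6) and (9.9)] -/
theorem ramificationIdx_le_index_of_inertia_inf_le_fixingSubgroup'
    (L : IntermediateField K (AlgebraicClosure K)) [FiniteDimensional K L] [IsGalois K L]
    (v : HeightOneSpectrum (𝓞 K)) {𝔓 : Ideal (absIntegers (𝓞 K) K)} (h𝔓 : 𝔓 ∈ v.primesAbove)
    (B : Subgroup (absoluteGaloisGroup K)) (hB : B.index ≠ 0)
    (hI : ∀ σ ∈ 𝔓.inertia (absoluteGaloisGroup K), σ ∈ B → ∀ x : L, σ • (x : AlgebraicClosure K) = x)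
    (Q : Ideal (𝓞 L)) [Q.IsPrime] [Q.LiesOver v.asIdeal] :
    Q.ramificationIdx (𝓞 K) ≤ B.index := by
  refine @ramificationIdx_le_index_of_inertia_inf_le_fixingSubgroup K _ _ L _ _ v 𝔓 h𝔓.1 h𝔓.2 B hB
    (fun σ hσ => ?_) Q _ _
  rw [IntermediateField.mem_fixingSubgroup_iff]
  intro x hx
  exact hI σ hσ.1 hσ.2 ⟨x, hx⟩

end Literature.NumberTheory.GaloisRepresentations

end
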